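import Summits.HodgeConjecture.HodgeConjecture.Theorems.LimitExtensionMiddleDivisorSupportSufficesSNCFact
import Summits.HodgeConjecture.HodgeConjecture.Theses.NodalSupport
import Summits.HodgeConjecture.HodgeConjecture.Theses.LinearSystemTorelli

/-!
# `DivisorInduction` (stmt-HodgeConjecture-1082) — unconditional

The support item `DivisorInduction`, shared verbatim by the routes `NodalSupport`,
`LinearSystemTorelli` and `LimitExtension` (stmt-HodgeConjecture-1082): for `1 ≤ p`, if rational
`(p-1,p-1)`-classes are algebraic on smooth projective `n`-folds, then on a smooth projective
`(n+1)`-fold every rational `(p,p)`-class supported on a divisor is algebraic (Deligne, Hodge III,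
Cor. 8.2.8 + semisimplicity; Thomas 2005 §2).

Since 2026-08-16T18:53Z the last named fact of the tree's reduction
`divisorInduction_of_deligne827snc` (file `Theorems/LimitExtensionMiddleDivisorSupportSufficesSNCFact`:
log resolution of the supporting divisor to an snc boundary, the snc principle of two types,
Voisin's lift of Hodge classes along the Gysin surjection, the codimension-`(p-1)` hypothesis on the
resolved components, push-forward) is a THEOREM:
`Literature.AlgebraicGeometry.HodgeTheory.Deligne1974_ker_pullback_eq_ker_pullback_snc_holds`
(file `HodgeTheory/GysinKernelSNC`: GAGA on the strata of the snc boundary,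
`Resolution.smoothOfRelativeDimension_stratum_of_hasSNC`, and the compact-Kähler principle of two
types `exists_isOpen_map_subsetIncl_eq_zero_of_strata`). This file applies it:

* `limitExtension_divisorInduction_proof : Theses.LimitExtension.DivisorInduction`,
* `nodalSupport_divisorInduction_proof : Theses.NodalSupport.DivisorInduction`,
* `linearSystemTorelli_divisorInduction_proof : Theses.LinearSystemTorelli.DivisorInduction`

— the three route decls of the one item, each literally, with no hypothesis. In route
`LimitExtension` this is the divisor-descent step `(n, p) = (3, 2)` of the fourfold milestone
`HodgeFourfolds` (stmt-HodgeConjecture-10866). No definitions, no named facts, no sorry.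
-/

-- `Summit.HodgeConjecture.HodgeConjecture.Theorems` is the mandated namespace (single-conjunct summit:
-- Sub = Summit), which `linter.dupNamespace` flags; off tree-wide in the lakefile, restated here so
-- stand-alone elaboration is warning-free too.
set_option linter.dupNamespace false

noncomputable section

namespace Summit.HodgeConjecture.HodgeConjecture.Theorems

/-- **`DivisorInduction` (stmt-HodgeConjecture-1082), route `LimitExtension` decl, unconditionally.**
For `1 ≤ p`: if rational `(p-1,p-1)`-classes are algebraic on every smooth projective `n`-fold, then
on every smooth projective `(n+1)`-fold a rational `(p,p)`-class supported on a divisor is algebraic.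
Proof: the tree's `divisorInduction_of_deligne827snc` (log resolution, Gysin lift, push-forward) on
the theorem `Deligne1974_ker_pullback_eq_ker_pullback_snc_holds` (Hodge III Prop. 8.2.7 for the
members of an snc boundary, by the principle of two types).
[cite: DeligneHodgeIII1974, Prop. 8.2.7 and Cor. 8.2.8 (p. 40)] [cite: Thomas2005Nodes, §2]
[cite: DeligneGriffithsMorganSullivan1975, §5–§6] -/
theorem limitExtension_divisorInduction_proof :
    Summit.HodgeConjecture.HodgeConjecture.Theses.LimitExtension.DivisorInduction :=
  divisorInduction_of_deligne827snc
    Literature.AlgebraicGeometry.HodgeTheory.Deligne1974_ker_pullback_eq_ker_pullback_snc_holds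

/-- **`DivisorInduction` (stmt-HodgeConjecture-1082), route `NodalSupport` decl, unconditionally** —
the same proposition as the `LimitExtension` decl (both unfold to the one signature of the item).
[cite: DeligneHodgeIII1974, Prop. 8.2.7 and Cor. 8.2.8 (p. 40)] [cite: Thomas2005Nodes, §2] -/
theorem nodalSupport_divisorInduction_proof :
    Summit.HodgeConjecture.HodgeConjecture.Theses.NodalSupport.DivisorInduction := by
  unfold Summit.HodgeConjecture.HodgeConjecture.Theses.NodalSupport.DivisorInduction
  exact limitExtension_divisorInduction_proof

/-- **`DivisorInduction` (stmt-HodgeConjecture-1082), route `LinearSystemTorelli` decl,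
unconditionally** — the same proposition again.
[cite: DeligneHodgeIII1974, Prop. 8.2.7 and Cor. 8.2.8 (p. 40)] [cite: Thomas2005Nodes, §2] -/
theorem linearSystemTorelli_divisorInduction_proof :
    Summit.HodgeConjecture.HodgeConjecture.Theses.LinearSystemTorelli.DivisorInduction := by
  unfold Summit.HodgeConjecture.HodgeConjecture.Theses.LinearSystemTorelli.DivisorInduction
  exact limitExtension_divisorInduction_proof

end Summit.HodgeConjecture.HodgeConjecture.Theorems

end
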